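import Literature.MathematicalPhysics.QuantumFieldTheory.Balaban1983to89.B9Thm31FriedrichsCoerciveZd

/-!
# `Balaban1983to89.B9Eq324DeltaPrimeUpperBoundZd` — [Balaban1985BackgroundPropagators] (3.23)–(3.24) p. 394 and Thm 3.11 p. 416 at the `ℤᵈ × 𝔸` carrier: an EXPLICIT UPPER
# BOUND `⟨f, Ω₀Δ′_a(U₀)Ω₀ f⟩_τ ≤ Θ·⟨f, f⟩_τ`, `Θ = 4d∕η² + Σ_{j≤m} a_j`, at every unitary background whose averaged transporters are unitary (the class (1.7)),
# whence `‖Ω₀Δ′_aΩ₀ h‖_τ ≤ Θ‖h‖_τ`, the LOWER bound `‖G′(U₀)ψ‖_τ ≥ Θ⁻¹‖ψ‖_τ`, and the first factor of an EXPLICIT constant for `(Q′G′²Q′*)⁻¹`: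
# `⟨φ, Q′G′²Q′*φ⟩_τ ≥ Θ⁻²·‖Q′*φ‖²_τ`

statement-level skeleton of published theorems with citation tags; proofs where landed; nothing here is a claim about the
Yang–Mills mass gap

`[Balaban1985BackgroundPropagators]` ("B9", CMP **99** (1985) 389–434) p. 393 (3.18)–(3.19) (`(Q′(U)λ)(y) = Σ_{x∈B(y)} L⁻ᵈ R(U(Γ_{y,x}))λ(x)`, `Q′_j`), p. 394
(3.23)–(3.25) (the form of `Δ′_a`, `G′ = (Ω₀Δ′_aΩ₀)⁻¹`, `Q′G′²Q′*`), p. 416 Thm 3.11 («Δ′_a, G′, (Q′G′²Q′*)⁻¹ … positive definite. This is obvious»);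
`[Balaban1984PropagatorsII]` ("[4]") p. 226, (2.22); `[Balaban1985Averaging]` Prop. 2 p. 26 (unitarity of the averaged transporters in the small-field window).
The bound `Θ` is elementary bookkeeping (`|D^η_{U,μ}f(x)|_τ ≤ η⁻¹(|f(x+e_μ)|_τ + |f(x)|_τ)` for unitary `U`; `Σ_y |(Q′g)(y)|²_τ ≤ L⁻ᵈ Σ_x |g(x)|²_τ` for unitary
transporters by Cauchy–Schwarz over the `Lᵈ` sites of a block); it is NOT uniform in `η` (print rescales).  PDF held: `paper:balaban1985-cmp99-background-propagators`
pp. 393–394, 416 (re-read 2026-08-28).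

CITATION HEADER (lean-in-tree rule).  Cell `pub-ymgap` (YM Track A, D-0062 ∕ D-0149), node N06 = [B9], width seat `pub-ymgap-dag-n06-w4` (g4), CLAIM-13 ∕ INTENT-13.  Inputs BY NAME:
dag-n06-w2 g4's `B9Eq342CombesThomasFormZd` (`fnorm`, `fnorm_sum_le`, `fnorm_smul`, `formE_self_eq_sum_sq`, `abs_formE_le`) and `B9Thm31GpDecayOfCoerciveZd` (`fnorm_conjR_of_unitary`,
`fnorm_sub_le`), this seat's g2 `B9Eq324DeltaPrimeAZd` (`formE_deltaPrimeADom`, `formE_deltaPrimeADom_symm`, `formE_deltaPrimeADom_self_nonneg`, `deltaPrimeADom_GpZd`, `GpZd`),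
`B9Eq325QGGQInvZd` (`levForm_qggq_self`, `QprimeStar`), g4 `B9Thm311InverseL2BoundsZd.sq_le_mul_of_symm_nonneg`, `B9Thm31FriedrichsCoerciveZd.re_trace_eq_fnorm_sq`, n06-b's
`B9Thm311PosDefNearFlatZd.bgT_mem_unitaryUnits_of_reg17UnivP`, `B7Eq78Linearization` (`Qprime_apply`, `QprimeIter_succ`, `zdBlocking`), `QuantumLattice.BalabanRG` (`blockSites`,
`mem_blockSites_iff`, `card_blockSites`).

WHAT IS PROVED (kernel, 0 sorry; theorems only — no `def`, `instance`, `notation`; faithful Hermitian tracial `τ` a PARAMETER).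
* §1 (gradient, EVERY unitary `U₀`) `fnorm_covDerivFwd_le`, `fnorm_covDerivFwd_sq_le`, ★ `gradEnergy_le_formE_self` (`Σ_ν Σ_x |(D^η_{U₀,ν}f)(x)|²_τ ≤ 4d·η⁻²·⟨f, f⟩_τ`).
* §2 (averaging, unitary level transporters `T`) ★ `fnorm_Qprime_sq_le` (`|(Q′g)(c)|²_τ ≤ L⁻ᵈ Σ_{x∈B(c)} |g(x)|²_τ`), ★ `sum_fnorm_QprimeIter_sq_le_formE` (`Σ_{c∈C} |(Q′_j f)(c)|²_τ ≤ ⟨f, f⟩_τ`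
  for every finite `C`, every `j`, `f ∈ L²(Ω₀, ·)`), `penalty_le_formE_self`.
* §3 ★★★ `formE_deltaPrimeADom_self_le` (`⟨f, Ω₀Δ′_a(U₀)Ω₀ f⟩_τ ≤ Θ·⟨f, f⟩_τ`, `Θ = 4d·η⁻² + Σ_{j≤m} a_j`, displayed `hT`: the averaged transporters up to level `m` are unitary).
* §4 ★★★ `formE_deltaPrimeADom_sq_le` (`‖Ω₀Δ′_aΩ₀ h‖²_τ ≤ Θ²‖h‖²_τ` — from the DIAGONAL form bound by two Cauchy–Schwarz steps, no spectral theory), ★★★ `formE_self_le_sq_mul_formE_GpZd`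
  (`‖ψ‖²_τ ≤ Θ²‖G′(U₀)ψ‖²_τ`), ★★★ `formE_QprimeStar_le_sq_mul_levForm_qggq` (`‖Q′*φ‖²_τ ≤ Θ²·⟨φ, Q′G′²Q′*φ⟩_τ` — the `G′`-factor of an explicit constant for STATION 2's `hco`).
* §5 (readings) `formE_deltaPrimeADom_self_le_of_reg17UnivP` ∕ `formE_QprimeStar_le_of_reg17UnivP` (the class (1.7) on `ℤᵈ` below `α_Q∕L²` discharges `hT`, `L ≥ 2`, `d > 0`),
  `formE_deltaPrimeADom_self_le_one` (`U₀ = 1`).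

HONEST SCOPE.  `Θ` depends on `η` (as `η⁻²`) and on `Σ a_j` — explicit but NOT uniform in the member; the second factor of STATION 2's constant (a quantitative injectivity
`‖Q′*φ‖²_τ ≥ κ⟨φ, φ⟩_τ`) is NOT in this file; no decay; `τ` a PARAMETER; count-neutral helper (`--supports` the K1 item of record); N05 ∕ N06 NOT discharged; K1 NOT closed; one
finite `𝕋⁴` programme at fixed `ε`, Bałaban as printed; R4 closes only the conditional finite-`𝕋⁴` rung `BalabanLadder.UV` — nothing continuum ∕ ℝ⁴ ∕ OS ∕ mass gap ∕ Clay.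
Unit `pub-ymgap-dag-n06-w4` (g4), 2026-08-28.
-/

noncomputable section

namespace Literature.MathematicalPhysics.QuantumFieldTheory.Balaban1983to89.B9Eq324DeltaPrimeUpperBoundZd

open Filter Topology
open Literature.MathematicalPhysics.QuantumLattice (blockSites mem_blockSites_iff card_blockSites)
open B7Prop1Explicit
open B7Eq78Linearization (conjR conjR_apply Qprime Qprime_apply QprimeIter QprimeIter_zero QprimeIter_succ zdBlocking)
open B7Prop2Explicit (unitaryUnits)
open B8Ineq132 (covDerivFwd)
open B8Eq119TwistedAxial (bgT bgT_one)
open B9Eq321LandauProjectionZd (suppSub formE formE_isSymm)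
open B9Eq324DeltaPrimeAZd (deltaPrimeADom GpZd deltaPrimeADom_GpZd formE_deltaPrimeADom formE_deltaPrimeADom_symm formE_deltaPrimeADom_self_nonneg)
open B9Eq325QGGQInvZd (levSupp levForm qggq QprimeStar levForm_qggq_self)
open B9Eq342CombesThomasFormZd (fnorm fnorm_nonneg fnorm_sq fnorm_smul fnorm_add_le fnorm_zero fnorm_sum_le formE_self_eq_sum_sq formE_self_nonneg' abs_formE_le)
open B9Thm31GpDecayOfCoerciveZd (fnorm_conjR_of_unitary fnorm_neg' fnorm_sub_le)
open B9Thm311InverseL2BoundsZd (sq_le_mul_of_symm_nonneg)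
open B9Thm31FriedrichsCoerciveZd (re_trace_eq_fnorm_sq)
open B9Eq316AveragingTransposeZd (Reg17 alphaQ)
open B9Thm311PosDefNearFlatZd (bgT_mem_unitaryUnits_of_reg17UnivP)
open B9Thm31CoercivePrimeCompactZd (plaqClosed_subset_reg17UnivP one_mem_plaqClosed)
open B8Ineq132 (plaqF)

export B7Prop1Explicit (Site)

variable {d : ℕ} {𝔸 : Type*} [CStarAlgebra 𝔸]
variable (τ : 𝔸 →ₗ[ℂ] ℂ) (hτp : ∀ a : 𝔸, a ≠ 0 → 0 < (τ (star a * a)).re)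
  (hτt : ∀ a b : 𝔸, τ (a * b) = τ (b * a)) (hτs : ∀ a : 𝔸, τ (star a) = starRingEnd ℂ (τ a))

/-! ## §1  The gradient energy is at most `4d·η⁻²·⟨f, f⟩_τ` (every unitary background) -/

section Gradient

variable {η : ℝ} {U₀ : Site d → Fin d → 𝔸ˣ}

include hτp hτt hτs in
/-- `|(D^η_{U₀,μ}F)(x)|_τ ≤ |η|⁻¹·(|F(x + e_μ)|_τ + |F(x)|_τ)` at a unitary background. [cite: Balaban1985RegularSpaces, (1.1) p.76; Balaban1985BackgroundPropagators, (3.23) p.394 (bookkeeping)] -/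
theorem fnorm_covDerivFwd_le (hU : ∀ (x : Site d) (κ : Fin d), U₀ x κ ∈ unitaryUnits 𝔸) (F : Site d → 𝔸) (μ : Fin d) (x : Site d) :
    fnorm τ (covDerivFwd η U₀ μ F x) ≤ |η|⁻¹ * (fnorm τ (F (x + e μ)) + fnorm τ (F x)) := by
  rw [covDerivFwd, fnorm_smul, abs_inv]
  refine mul_le_mul_of_nonneg_left ?_ (inv_nonneg.2 (abs_nonneg η))
  calc fnorm τ (conjR (U₀ x μ) (F (x + e μ)) - F x) ≤ fnorm τ (conjR (U₀ x μ) (F (x + e μ))) + fnorm τ (F x) := fnorm_sub_le τ hτp hτs _ _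
    _ = fnorm τ (F (x + e μ)) + fnorm τ (F x) := by rw [fnorm_conjR_of_unitary τ hτt (hU x μ)]

include hτp hτt hτs in
/-- `|(D^η_{U₀,μ}F)(x)|²_τ ≤ 2η⁻²·(|F(x + e_μ)|²_τ + |F(x)|²_τ)`. [cite: Balaban1985BackgroundPropagators, (3.23) p.394 (bookkeeping)] -/
theorem fnorm_covDerivFwd_sq_le (hU : ∀ (x : Site d) (κ : Fin d), U₀ x κ ∈ unitaryUnits 𝔸) (F : Site d → 𝔸) (μ : Fin d) (x : Site d) :
    fnorm τ (covDerivFwd η U₀ μ F x) ^ 2 ≤ 2 * (η ^ 2)⁻¹ * (fnorm τ (F (x + e μ)) ^ 2 + fnorm τ (F x) ^ 2) := by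
  have h := fnorm_covDerivFwd_le τ hτp hτt hτs hU F μ x (η := η)
  have h0 : 0 ≤ fnorm τ (covDerivFwd η U₀ μ F x) := fnorm_nonneg τ _
  have h2 := pow_le_pow_left₀ h0 h 2
  have ha := fnorm_nonneg τ (F (x + e μ))
  have hb := fnorm_nonneg τ (F x)
  calc fnorm τ (covDerivFwd η U₀ μ F x) ^ 2 ≤ (|η|⁻¹ * (fnorm τ (F (x + e μ)) + fnorm τ (F x))) ^ 2 := h2
    _ = (η ^ 2)⁻¹ * (fnorm τ (F (x + e μ)) + fnorm τ (F x)) ^ 2 := by rw [mul_pow, inv_pow, sq_abs]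
    _ ≤ (η ^ 2)⁻¹ * (2 * (fnorm τ (F (x + e μ)) ^ 2 + fnorm τ (F x) ^ 2)) :=
        mul_le_mul_of_nonneg_left (by nlinarith [sq_nonneg (fnorm τ (F (x + e μ)) - fnorm τ (F x))]) (inv_nonneg.2 (sq_nonneg η))
    _ = 2 * (η ^ 2)⁻¹ * (fnorm τ (F (x + e μ)) ^ 2 + fnorm τ (F x) ^ 2) := by ring

include hτp in
/-- a sum of `|f(·)|²_τ` over any finite set is at most `⟨f, f⟩_τ` (`f` vanishes off `Ω₀`). [cite: Balaban1985BackgroundPropagators, (3.21) p.394 (bookkeeping)] -/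
theorem sum_fnorm_sq_le_formE {s : Finset (Site d)} (f : suppSub (𝔸 := 𝔸) s) (T : Finset (Site d)) :
    ∑ x ∈ T, fnorm τ ((f : Site d → 𝔸) x) ^ 2 ≤ formE τ s f f := by
  classical
  rw [formE_self_eq_sum_sq hτp f]
  calc ∑ x ∈ T, fnorm τ ((f : Site d → 𝔸) x) ^ 2 = ∑ x ∈ T ∩ s, fnorm τ ((f : Site d → 𝔸) x) ^ 2 := by
        symm
        refine Finset.sum_subset Finset.inter_subset_left fun x hxT hx => ?_
        have hxs : x ∉ s := fun h => hx (Finset.mem_inter.2 ⟨hxT, h⟩)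
        rw [f.2 x hxs, fnorm_zero]; ring
    _ ≤ ∑ x ∈ s, fnorm τ ((f : Site d → 𝔸) x) ^ 2 := Finset.sum_le_sum_of_subset_of_nonneg Finset.inter_subset_right fun x _ _ => sq_nonneg _

include hτp hτt hτs in
/-- ★ **`Σ_ν Σ_x |(D^η_{U₀,ν}f)(x)|²_τ ≤ 4d·η⁻²·⟨f, f⟩_τ`** for `f ∈ L²(Ω₀, ·)` at EVERY unitary background.
[cite: Balaban1985BackgroundPropagators, (3.23) p.394; Balaban1985RegularSpaces, (1.1) p.76] -/
theorem gradEnergy_le_formE_self (hU : ∀ (x : Site d) (κ : Fin d), U₀ x κ ∈ unitaryUnits 𝔸) {s : Finset (Site d)} (f : suppSub (𝔸 := 𝔸) s) :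
    ∑ ν : Fin d, ∑ᶠ x, (τ (star (covDerivFwd η U₀ ν (f : Site d → 𝔸) x) * covDerivFwd η U₀ ν (f : Site d → 𝔸) x)).re ≤ 4 * d * (η ^ 2)⁻¹ * formE τ s f f := by
  classical
  set F : Site d → 𝔸 := (f : Site d → 𝔸) with hF
  have hdir : ∀ ν : Fin d, ∑ᶠ x, (τ (star (covDerivFwd η U₀ ν F x) * covDerivFwd η U₀ ν F x)).re ≤ 4 * (η ^ 2)⁻¹ * formE τ s f f := by
    intro ν
    -- the support of `D_ν F` lies in `T = s ∪ (s − e_ν)`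
    set T : Finset (Site d) := s ∪ s.image (fun z => z - e ν) with hT
    have hsupp : (Function.support fun x => (τ (star (covDerivFwd η U₀ ν F x) * covDerivFwd η U₀ ν F x)).re) ⊆ ↑T := by
      intro x hx
      rw [Function.mem_support] at hx
      by_contra hxT
      rw [hT, Finset.coe_union, Set.mem_union, Finset.mem_coe, Finset.coe_image, Set.mem_image] at hxT
      simp only [not_or, not_exists, not_and] at hxT
      apply hx
      have h1 : F x = 0 := f.2 x hxT.1
      have h2 : F (x + e ν) = 0 := by
        by_contra hne
        have hmem : x + e ν ∈ s := by by_contra hh; exact hne (f.2 _ hh)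
        exact hxT.2 (x + e ν) (Finset.mem_coe.2 hmem) (by simp)
      rw [covDerivFwd, h1, h2, conjR_apply, mul_zero, zero_mul, sub_zero, smul_zero, star_zero, zero_mul, map_zero, Complex.zero_re]
    rw [finsum_eq_sum_of_support_subset _ hsupp]
    have hpt : ∀ x ∈ T, (τ (star (covDerivFwd η U₀ ν F x) * covDerivFwd η U₀ ν F x)).re ≤ 2 * (η ^ 2)⁻¹ * (fnorm τ (F (x + e ν)) ^ 2 + fnorm τ (F x) ^ 2) := by
      intro x _
      rw [re_trace_eq_fnorm_sq τ hτp]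
      exact fnorm_covDerivFwd_sq_le τ hτp hτt hτs hU F ν x
    refine (Finset.sum_le_sum hpt).trans ?_
    rw [← Finset.mul_sum, Finset.sum_add_distrib]
    have hA : ∑ x ∈ T, fnorm τ (F x) ^ 2 ≤ formE τ s f f := sum_fnorm_sq_le_formE τ hτp f T
    have hB : ∑ x ∈ T, fnorm τ (F (x + e ν)) ^ 2 ≤ formE τ s f f := by
      rw [← Finset.sum_image (f := fun y => fnorm τ (F y) ^ 2) (s := T) (g := fun x => x + e ν) fun x _ y _ h => add_right_cancel h]
      exact sum_fnorm_sq_le_formE τ hτp f _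
    have hη2 : 0 ≤ 2 * (η ^ 2)⁻¹ := by positivity
    nlinarith
  calc ∑ ν : Fin d, ∑ᶠ x, (τ (star (covDerivFwd η U₀ ν F x) * covDerivFwd η U₀ ν F x)).re ≤ ∑ _ν : Fin d, 4 * (η ^ 2)⁻¹ * formE τ s f f :=
        Finset.sum_le_sum fun ν _ => hdir ν
    _ = 4 * d * (η ^ 2)⁻¹ * formE τ s f f := by rw [Finset.sum_const, Finset.card_univ, Fintype.card_fin, nsmul_eq_mul]; ring

end Gradient

/-! ## §2  The averaging operators contract `Σ |·|²_τ` (unitary level transporters) -/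

section Averaging

variable {L : ℕ} [NeZero L]

include hτp hτt hτs in
/-- ★ **`|(Q′g)(c)|²_τ ≤ L⁻ᵈ·Σ_{x∈B(c)} |g(x)|²_τ`** for one averaging step (3.18) with unitary transporters (`|Σ_x L⁻ᵈR(T_x)g(x)|_τ ≤ L⁻ᵈΣ_x|g(x)|_τ`, then Cauchy–Schwarz over the `Lᵈ`
sites of the block). [cite: Balaban1985BackgroundPropagators, (3.18) p.393; Balaban1985Averaging, (78) p.30, Prop. 2 p.26] -/
theorem fnorm_Qprime_sq_le {T : Site d → 𝔸ˣ} (hT : ∀ x, T x ∈ unitaryUnits 𝔸) (g : Site d → 𝔸) (c : Site d) :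
    fnorm τ (Qprime (blockSites L c) (fun _ => ((L : ℝ) ^ d)⁻¹) T g) ^ 2 ≤ ((L : ℝ) ^ d)⁻¹ * ∑ x ∈ blockSites L c, fnorm τ (g x) ^ 2 := by
  have hLd : (0 : ℝ) < (L : ℝ) ^ d := by
    have : (0 : ℝ) < L := by exact_mod_cast Nat.pos_of_ne_zero (NeZero.ne L)
    positivity
  have h1 : fnorm τ (Qprime (blockSites L c) (fun _ => ((L : ℝ) ^ d)⁻¹) T g) ≤ ((L : ℝ) ^ d)⁻¹ * ∑ x ∈ blockSites L c, fnorm τ (g x) := by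
    rw [Qprime_apply]
    refine (fnorm_sum_le hτp hτs _ _).trans ?_
    rw [Finset.mul_sum]
    refine Finset.sum_le_sum fun x _ => ?_
    rw [fnorm_smul, fnorm_conjR_of_unitary τ hτt (hT x), abs_of_pos (inv_pos.2 hLd)]
  have h0 : 0 ≤ fnorm τ (Qprime (blockSites L c) (fun _ => ((L : ℝ) ^ d)⁻¹) T g) := fnorm_nonneg τ _
  have hCS := sq_sum_le_card_mul_sum_sq (s := blockSites L c) (f := fun x => fnorm τ (g x))
  rw [card_blockSites] at hCS
  push_cast at hCS
  calc fnorm τ (Qprime (blockSites L c) (fun _ => ((L : ℝ) ^ d)⁻¹) T g) ^ 2 ≤ (((L : ℝ) ^ d)⁻¹ * ∑ x ∈ blockSites L c, fnorm τ (g x)) ^ 2 :=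
        pow_le_pow_left₀ h0 h1 2
    _ = (((L : ℝ) ^ d)⁻¹) ^ 2 * (∑ x ∈ blockSites L c, fnorm τ (g x)) ^ 2 := by rw [mul_pow]
    _ ≤ (((L : ℝ) ^ d)⁻¹) ^ 2 * ((L : ℝ) ^ d * ∑ x ∈ blockSites L c, fnorm τ (g x) ^ 2) := mul_le_mul_of_nonneg_left hCS (sq_nonneg _)
    _ = ((L : ℝ) ^ d)⁻¹ * ∑ x ∈ blockSites L c, fnorm τ (g x) ^ 2 := by field_simp

include hτp hτt hτs in
/-- ★ **`Σ_{c∈C} |(Q′_j f)(c)|²_τ ≤ ⟨f, f⟩_τ`** for every finite `C`, every level `j` and every `f ∈ L²(Ω₀, ·)`, when the level transporters below `j` are unitary (the blocks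
`B(c)`, `c ∈ C`, are pairwise disjoint, and `L⁻ᵈ ≤ 1`). [cite: Balaban1985BackgroundPropagators, (3.19) p.393, (3.23) p.394; Balaban1985Averaging, Prop. 2 p.26] -/
theorem sum_fnorm_QprimeIter_sq_le_formE {T : ℕ → Site d → Site d → 𝔸ˣ} {s : Finset (Site d)} (f : suppSub (𝔸 := 𝔸) s) :
    ∀ j : ℕ, (∀ j', j' < j → ∀ c x, T j' c x ∈ unitaryUnits 𝔸) →
      ∀ C : Finset (Site d), ∑ c ∈ C, fnorm τ (QprimeIter (zdBlocking d L) T j (f : Site d → 𝔸) c) ^ 2 ≤ formE τ s f f := by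
  classical
  intro j
  induction j with
  | zero =>
    intro _ C
    simpa only [QprimeIter_zero] using sum_fnorm_sq_le_formE τ hτp f C
  | succ j ih =>
    intro hT C
    have hTj : ∀ j', j' < j → ∀ c x, T j' c x ∈ unitaryUnits 𝔸 := fun j' hj' => hT j' (Nat.lt_succ_of_lt hj')
    have hLd1 : ((L : ℝ) ^ d)⁻¹ ≤ 1 := by
      have hL1 : (1 : ℝ) ≤ L := by exact_mod_cast Nat.pos_of_ne_zero (NeZero.ne L)
      exact inv_le_one_of_one_le₀ (one_le_pow₀ hL1)
    have hLd0 : 0 ≤ ((L : ℝ) ^ d)⁻¹ := by positivity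
    -- one step, block by block
    have hstep : ∀ c ∈ C, fnorm τ (QprimeIter (zdBlocking d L) T (j + 1) (f : Site d → 𝔸) c) ^ 2 ≤
        ((L : ℝ) ^ d)⁻¹ * ∑ x ∈ blockSites L c, fnorm τ (QprimeIter (zdBlocking d L) T j (f : Site d → 𝔸) x) ^ 2 := by
      intro c _
      rw [QprimeIter_succ]
      exact fnorm_Qprime_sq_le τ hτp hτt hτs (hT j (Nat.lt_succ_self j) c) _ c
    refine (Finset.sum_le_sum hstep).trans ?_
    rw [← Finset.mul_sum]
    -- the blocks are pairwise disjoint: the double sum is a sum over `C.biUnion B`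
    have hdisj : (↑C : Set (Site d)).PairwiseDisjoint (blockSites L) := by
      intro c₁ _ c₂ _ hne
      rw [Function.onFun, Finset.disjoint_left]
      intro x hx₁ hx₂
      rw [mem_blockSites_iff] at hx₁ hx₂
      exact hne (hx₁.symm.trans hx₂)
    rw [← Finset.sum_biUnion hdisj]
    calc ((L : ℝ) ^ d)⁻¹ * ∑ x ∈ C.biUnion (blockSites L), fnorm τ (QprimeIter (zdBlocking d L) T j (f : Site d → 𝔸) x) ^ 2
        ≤ 1 * formE τ s f f := mul_le_mul hLd1 (ih hTj _) (Finset.sum_nonneg fun x _ => sq_nonneg _) zero_le_one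
      _ = formE τ s f f := one_mul _

include hτp hτt hτs in
/-- **THE PENALTY IS AT MOST `(Σ_{j≤m} a_j)·⟨f, f⟩_τ`** (`a ≥ 0`, averaged transporters unitary up to level `m`).
[cite: Balaban1985BackgroundPropagators, (3.23)–(3.24) p.394] -/
theorem penalty_le_formE_self {U₀ : Site d → Fin d → 𝔸ˣ} (m : ℕ) {a : ℕ → ℝ} (ha : ∀ j, 0 ≤ a j) (Λ : ℕ → Finset (Site d)) {s : Finset (Site d)}
    (hT : ∀ j, j ≤ m → ∀ (z y : Site d), bgT L U₀ j z y ∈ unitaryUnits 𝔸) (f : suppSub (𝔸 := 𝔸) s) :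
    ∑ j ∈ Finset.range (m + 1), a j * ∑ y ∈ Λ j,
        (τ (star (QprimeIter (zdBlocking d L) (bgT L U₀) j (f : Site d → 𝔸) y) * QprimeIter (zdBlocking d L) (bgT L U₀) j (f : Site d → 𝔸) y)).re ≤
      (∑ j ∈ Finset.range (m + 1), a j) * formE τ s f f := by
  rw [Finset.sum_mul]
  refine Finset.sum_le_sum fun j hj => mul_le_mul_of_nonneg_left ?_ (ha j)
  have hjm : j ≤ m := Nat.lt_succ_iff.1 (Finset.mem_range.1 hj)
  have h := sum_fnorm_QprimeIter_sq_le_formE τ hτp hτt hτs (L := L) (T := bgT L U₀) f j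
    (fun j' hj' c x => hT j' (le_trans hj'.le hjm) c x) (Λ j)
  refine le_trans (le_of_eq (Finset.sum_congr rfl fun y _ => re_trace_eq_fnorm_sq τ hτp _)) h

end Averaging

/-! ## §3  The explicit upper bound `Θ = 4d·η⁻² + Σ_{j≤m} a_j` for the form of `Ω₀Δ′_a(U₀)Ω₀` -/

section Upper

variable [FiniteDimensional ℝ 𝔸] {L : ℕ} [NeZero L] {η : ℝ} {U₀ : Site d → Fin d → 𝔸ˣ}

include hτt hτs in
/-- ★★★ **`⟨f, Ω₀Δ′_a(U₀)Ω₀ f⟩_τ ≤ (4d·η⁻² + Σ_{j≤m} a_j)·⟨f, f⟩_τ`** at a unitary background whose averaged transporters up to level `m` are unitary (`a ≥ 0`).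
[cite: Balaban1985BackgroundPropagators, (3.23)–(3.24) p.394; Balaban1985Averaging, Prop. 2 p.26] -/
theorem formE_deltaPrimeADom_self_le (hU : ∀ (x : Site d) (κ : Fin d), U₀ x κ ∈ unitaryUnits 𝔸) (m : ℕ) {a : ℕ → ℝ} (ha : ∀ j, 0 ≤ a j)
    (Λ : ℕ → Finset (Site d)) {s : Finset (Site d)} (hT : ∀ j, j ≤ m → ∀ (z y : Site d), bgT L U₀ j z y ∈ unitaryUnits 𝔸) (f : suppSub (𝔸 := 𝔸) s) :
    formE τ s f (deltaPrimeADom L U₀ η τ hτp m a Λ s f) ≤ (4 * d * (η ^ 2)⁻¹ + ∑ j ∈ Finset.range (m + 1), a j) * formE τ s f f := by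
  rw [formE_deltaPrimeADom (L := L) (m := m) (a := a) (Λ := Λ) τ hτp hτt hτs hU f f, add_mul]
  exact add_le_add (gradEnergy_le_formE_self τ hτp hτt hτs hU f) (penalty_le_formE_self τ hτp hτt hτs m ha Λ hT f)

/-! ## §4  From the diagonal form bound to operator bounds: `‖Δ′h‖ ≤ Θ‖h‖`, `‖G′ψ‖ ≥ Θ⁻¹‖ψ‖`, `⟨φ, Q′G′²Q′*φ⟩ ≥ Θ⁻²‖Q′*φ‖²` -/

include hτt hτs in
/-- ★★★ **`‖Ω₀Δ′_a(U₀)Ω₀ h‖²_τ ≤ Θ²·‖h‖²_τ`**, `Θ = 4d·η⁻² + Σ_{j≤m} a_j`: with `ψ = Δ′h` and the positive symmetric form `B(u, v) = ⟨u, Δ′v⟩_τ`,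
`‖ψ‖⁴ = B(ψ, h)² ≤ B(ψ, ψ)·B(h, h) ≤ Θ‖ψ‖²·⟨h, ψ⟩ ≤ Θ‖ψ‖²·‖h‖‖ψ‖`. [cite: Balaban1985BackgroundPropagators, (3.23)–(3.24) p.394, Thm 3.11 p.416; Balaban1984PropagatorsII, (2.22) p.226] -/
theorem formE_deltaPrimeADom_sq_le (hU : ∀ (x : Site d) (κ : Fin d), U₀ x κ ∈ unitaryUnits 𝔸) (m : ℕ) {a : ℕ → ℝ} (ha : ∀ j, 0 ≤ a j)
    (Λ : ℕ → Finset (Site d)) {s : Finset (Site d)} (hT : ∀ j, j ≤ m → ∀ (z y : Site d), bgT L U₀ j z y ∈ unitaryUnits 𝔸) (h : suppSub (𝔸 := 𝔸) s) :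
    formE τ s (deltaPrimeADom L U₀ η τ hτp m a Λ s h) (deltaPrimeADom L U₀ η τ hτp m a Λ s h) ≤
      (4 * d * (η ^ 2)⁻¹ + ∑ j ∈ Finset.range (m + 1), a j) ^ 2 * formE τ s h h := by
  set Θ : ℝ := 4 * d * (η ^ 2)⁻¹ + ∑ j ∈ Finset.range (m + 1), a j with hΘ
  set Δ := deltaPrimeADom L U₀ η τ hτp m a Λ s with hΔ
  set ψ := Δ h with hψ
  -- the positive symmetric form `B(u,v) = ⟨u, Δ′v⟩`
  set B : suppSub (𝔸 := 𝔸) s →ₗ[ℝ] suppSub (𝔸 := 𝔸) s →ₗ[ℝ] ℝ := (formE τ s).compl₂ Δ with hB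
  have hBapp : ∀ u v, B u v = formE τ s u (Δ v) := fun u v => rfl
  have hBsymm : ∀ u v, B u v = B v u := fun u v => by
    rw [hBapp, hBapp, hΔ]
    exact formE_deltaPrimeADom_symm (L := L) (m := m) (a := a) (Λ := Λ) τ hτp hτt hτs hU v u
  have hBnn : ∀ v, 0 ≤ B v v := fun v => by
    rw [hBapp, hΔ]; exact formE_deltaPrimeADom_self_nonneg (L := L) (m := m) (a := a) (Λ := Λ) τ hτp hτt hτs hU ha v
  have hΘ0 : 0 ≤ Θ := by
    have : 0 ≤ ∑ j ∈ Finset.range (m + 1), a j := Finset.sum_nonneg fun j _ => ha j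
    positivity
  -- the quantities
  set P := formE τ s ψ ψ with hP
  set Hh := formE τ s h h with hHh
  have hP0 : 0 ≤ P := formE_self_nonneg' hτp ψ
  have hH0 : 0 ≤ Hh := formE_self_nonneg' hτp h
  have h1 : P = B ψ h := by rw [hBapp]
  have hCS1 : (B ψ h) ^ 2 ≤ B ψ ψ * B h h := sq_le_mul_of_symm_nonneg B hBsymm hBnn ψ h
  have hdiag : B ψ ψ ≤ Θ * P := by rw [hBapp]; exact formE_deltaPrimeADom_self_le τ hτp hτt hτs hU m ha Λ hT ψ
  have hBhh : B h h = formE τ s h ψ := by rw [hBapp]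
  have hCS2 : (formE τ s h ψ) ^ 2 ≤ Hh * P :=
    sq_le_mul_of_symm_nonneg (formE τ s) (fun u v => (formE_isSymm τ s hτs).eq u v) (fun v => formE_self_nonneg' hτp v) h ψ
  -- `P² ≤ Θ P · B h h` and `(B h h)² ≤ Hh P` ⟹ `P⁴ ≤ Θ² P² Hh P` ⟹ `P ≤ Θ² Hh`
  have hBhh0 : 0 ≤ B h h := hBnn h
  have key : P ^ 2 ≤ Θ * P * B h h := by
    rw [h1]
    calc (B ψ h) ^ 2 ≤ B ψ ψ * B h h := hCS1
      _ ≤ Θ * P * B h h := mul_le_mul_of_nonneg_right hdiag hBhh0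
  by_cases hP' : P = 0
  · rw [hP']; positivity
  have hPpos : 0 < P := lt_of_le_of_ne hP0 (Ne.symm hP')
  have k2 : P ≤ Θ * B h h := by
    have := key
    rw [sq, mul_assoc, mul_comm] at this
    -- P * P ≤ (Θ * B h h) * P after rearranging
    nlinarith
  have k3 : P ^ 2 ≤ Θ ^ 2 * (B h h) ^ 2 := by
    have := pow_le_pow_left₀ hP0 k2 2
    rwa [mul_pow] at this
  rw [hBhh] at k3
  have k4 : P ^ 2 ≤ Θ ^ 2 * (Hh * P) := k3.trans (mul_le_mul_of_nonneg_left hCS2 (sq_nonneg Θ))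
  -- divide by `P > 0`
  have k5 : P * P ≤ (Θ ^ 2 * Hh) * P := by rw [← sq]; linarith [k4]
  exact le_of_mul_le_mul_right k5 hPpos

include hτt hτs in
/-- ★★★ **`‖ψ‖²_τ ≤ Θ²·‖G′(U₀)ψ‖²_τ`** — the explicit LOWER bound for `G′ = (Ω₀Δ′_aΩ₀)⁻¹` (`ψ = Δ′(G′ψ)`; `0 < d`, `η ≠ 0`, `a ≥ 0`).
[cite: Balaban1985BackgroundPropagators, (3.24) p.394, Thm 3.11 p.416; Balaban1984PropagatorsII, (2.22) p.226] -/
theorem formE_self_le_sq_mul_formE_GpZd (hd : 0 < d) (hη : η ≠ 0) (hU : ∀ (x : Site d) (κ : Fin d), U₀ x κ ∈ unitaryUnits 𝔸) (m : ℕ) {a : ℕ → ℝ} (ha : ∀ j, 0 ≤ a j)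
    (Λ : ℕ → Finset (Site d)) {s : Finset (Site d)} (hT : ∀ j, j ≤ m → ∀ (z y : Site d), bgT L U₀ j z y ∈ unitaryUnits 𝔸) (ψ : suppSub (𝔸 := 𝔸) s) :
    formE τ s ψ ψ ≤ (4 * d * (η ^ 2)⁻¹ + ∑ j ∈ Finset.range (m + 1), a j) ^ 2 *
      formE τ s (GpZd L U₀ η τ hτp m a Λ s hd hη hτt hτs hU ha ψ) (GpZd L U₀ η τ hτp m a Λ s hd hη hτt hτs hU ha ψ) := by
  have h := formE_deltaPrimeADom_sq_le τ hτp hτt hτs hU m ha Λ hT (GpZd L U₀ η τ hτp m a Λ s hd hη hτt hτs hU ha ψ) (η := η)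
  rwa [deltaPrimeADom_GpZd hd hη hτt hτs hU ha ψ] at h

include hτt hτs in
/-- ★★★ **`‖Q′*φ‖²_τ ≤ Θ²·⟨φ, Q′G′²Q′*φ⟩_τ`** — the `G′`-factor of an EXPLICIT constant for `(Q′G′²Q′*)⁻¹` (STATION 2's `hco`): `⟨φ, Q′G′²Q′*φ⟩_τ = ‖G′Q′*φ‖²_τ ≥ Θ⁻²‖Q′*φ‖²_τ`.
[cite: Balaban1985BackgroundPropagators, (3.25) p.394, Thm 3.11 p.416 («(Q′G′²Q′*)⁻¹ … positive definite»)] -/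
theorem formE_QprimeStar_le_sq_mul_levForm_qggq (hd : 0 < d) (hη : η ≠ 0) (hU : ∀ (x : Site d) (κ : Fin d), U₀ x κ ∈ unitaryUnits 𝔸) (m : ℕ) {a : ℕ → ℝ}
    (ha : ∀ j, 0 ≤ a j) (Λ : ℕ → Finset (Site d)) {s : Finset (Site d)} (hT : ∀ j, j ≤ m → ∀ (z y : Site d), bgT L U₀ j z y ∈ unitaryUnits 𝔸)
    (φ : levSupp (𝔸 := 𝔸) m Λ) :
    formE τ s (QprimeStar L U₀ τ m Λ s hτp φ) (QprimeStar L U₀ τ m Λ s hτp φ) ≤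
      (4 * d * (η ^ 2)⁻¹ + ∑ j ∈ Finset.range (m + 1), a j) ^ 2 * levForm τ m Λ φ (qggq L U₀ η τ hτp m a Λ s hd hη hτt hτs hU ha φ) := by
  rw [levForm_qggq_self]
  exact formE_self_le_sq_mul_formE_GpZd τ hτp hτt hτs hd hη hU m ha Λ hT _

end Upper

/-! ## §5  Readings: the class (1.7) on `ℤᵈ` discharges `hT`; the flat background -/

section Readings

variable [FiniteDimensional ℝ 𝔸] [Nontrivial 𝔸] {L : ℕ} [NeZero L] {η : ℝ}

include hτt hτs in
/-- ★★ **ON THE CLASS (1.7) ON `ℤᵈ` BELOW `α_Q∕L²`** (`L ≥ 2`, `d > 0`): `⟨f, Ω₀Δ′_a(U₀)Ω₀ f⟩_τ ≤ Θ·⟨f, f⟩_τ` with no displayed transporter hypothesis.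
[cite: Balaban1985BackgroundPropagators, (3.23)–(3.24) p.394; Balaban1985Averaging, Prop. 2 p.26; Balaban1985RegularSpaces, (1.7) p.77] -/
theorem formE_deltaPrimeADom_self_le_of_reg17UnivP (hd : 0 < d) (hL : 2 ≤ L) (m : ℕ) {a : ℕ → ℝ} (ha : ∀ j, 0 ≤ a j) (Λ : ℕ → Finset (Site d))
    {s : Finset (Site d)} {U₀ : Site d → Fin d → 𝔸ˣ} (hU : ∀ (x : Site d) (κ : Fin d), U₀ x κ ∈ unitaryUnits 𝔸)
    (hreg : Reg17 L m (fun _ => (Set.univ : Set (Site d))) (alphaQ d L / (L : ℝ) ^ 2) U₀) (f : suppSub (𝔸 := 𝔸) s) :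
    formE τ s f (deltaPrimeADom L U₀ η τ hτp m a Λ s f) ≤ (4 * d * (η ^ 2)⁻¹ + ∑ j ∈ Finset.range (m + 1), a j) * formE τ s f f :=
  formE_deltaPrimeADom_self_le τ hτp hτt hτs hU m ha Λ (bgT_mem_unitaryUnits_of_reg17UnivP hd hL m hU hreg) f

include hτt hτs in
/-- ★★ **ON THE CLASS (1.7)**: `‖Q′*φ‖²_τ ≤ Θ²·⟨φ, Q′G′²Q′*φ⟩_τ` with no displayed transporter hypothesis.
[cite: Balaban1985BackgroundPropagators, (3.25) p.394, Thm 3.11 p.416; Balaban1985Averaging, Prop. 2 p.26] -/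
theorem formE_QprimeStar_le_of_reg17UnivP (hd : 0 < d) (hL : 2 ≤ L) (hη : η ≠ 0) (m : ℕ) {a : ℕ → ℝ} (ha : ∀ j, 0 ≤ a j) (Λ : ℕ → Finset (Site d))
    {s : Finset (Site d)} {U₀ : Site d → Fin d → 𝔸ˣ} (hU : ∀ (x : Site d) (κ : Fin d), U₀ x κ ∈ unitaryUnits 𝔸)
    (hreg : Reg17 L m (fun _ => (Set.univ : Set (Site d))) (alphaQ d L / (L : ℝ) ^ 2) U₀) (φ : levSupp (𝔸 := 𝔸) m Λ) :
    formE τ s (QprimeStar L U₀ τ m Λ s hτp φ) (QprimeStar L U₀ τ m Λ s hτp φ) ≤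
      (4 * d * (η ^ 2)⁻¹ + ∑ j ∈ Finset.range (m + 1), a j) ^ 2 * levForm τ m Λ φ (qggq L U₀ η τ hτp m a Λ s hd hη hτt hτs hU ha φ) :=
  formE_QprimeStar_le_sq_mul_levForm_qggq τ hτp hτt hτs hd hη hU m ha Λ (bgT_mem_unitaryUnits_of_reg17UnivP hd hL m hU hreg) φ

omit [Nontrivial 𝔸] in
include hτt hτs in
/-- **AT THE FLAT BACKGROUND** (`U₀ = 1`: all transporters are `1`): `⟨f, Ω₀Δ′_a(1)Ω₀ f⟩_τ ≤ Θ·⟨f, f⟩_τ`. [cite: Balaban1985BackgroundPropagators, (3.23)–(3.24) p.394; Balaban1984PropagatorsII, p.226] -/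
theorem formE_deltaPrimeADom_self_le_one (m : ℕ) {a : ℕ → ℝ} (ha : ∀ j, 0 ≤ a j) (Λ : ℕ → Finset (Site d)) {s : Finset (Site d)} (f : suppSub (𝔸 := 𝔸) s) :
    formE τ s f (deltaPrimeADom L (1 : Site d → Fin d → 𝔸ˣ) η τ hτp m a Λ s f) ≤ (4 * d * (η ^ 2)⁻¹ + ∑ j ∈ Finset.range (m + 1), a j) * formE τ s f f :=
  formE_deltaPrimeADom_self_le τ hτp hτt hτs (one_mem_plaqClosed (d := d) (𝔸 := 𝔸) (β := 0) le_rfl).1 m ha Λ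
    (fun j _ z y => show bgT L (1 : Site d → Fin d → 𝔸ˣ) j z y ∈ unitaryUnits 𝔸 by rw [bgT_one]; exact (unitaryUnits 𝔸).one_mem) f

end Readings

end Literature.MathematicalPhysics.QuantumFieldTheory.Balaban1983to89.B9Eq324DeltaPrimeUpperBoundZd

end
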